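import Literature.Computability.Complexity.AlmostPProofs
import Literature.Computability.QuantumComplexity.PromiseClassesRel
import Literature.Computability.QuantumComplexity.CountingSimulationRelProofs
import Literature.Computability.QuantumComplexity.SimUniformity
import Literature.Computability.Cryptography.ClassBQP
import Summits.QuantumAdvantage.QuantumAdvantage.Statement
import HarnessLib

/-!
# Under the summit, `P^A ≠ BQP^A` and the quantum floor fails for almost every oracle

Solo seat `solo-QuantumAdvantage-informed`, session 7, file 22; sharpening of file 21 and of the
tree's `not_ae_P_eq_BQP_of_summit_holds` (`Literature.Barriers.QuantumAdvantage.RandomOracleMethodProofs`: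
under the summit, `P^A = BQP^A` does NOT hold almost surely) to the ALMOST-SURE failure, without a
zero-one law.

The observation is that Bennett–Gill's descent `ALMOST-P ⊆ BPP` (tree `AlmostPProofs`: countable
pigeonhole → a machine correct on a set of oracles of positive measure → a dense cylinder → lazy
sampling) consumes only POSITIVE measure: `mem_BPP_of_measure_ne_zero` — if `{A | L ∈ P^A}` is not
null then `L ∈ BPP`. Hence Fortnow–Rogers' Thm. 4.4 in positive-measure form
(`BQP_eq_BPP_of_not_ae_ne`: if `P^A = BQP^A` on a non-null set of oracles then `BQP = BPP`) and,
contrapositively, the summit's random-oracle shadow: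

* `ae_PRel_ne_BQPRel_of_quantumAdvantage : QuantumAdvantage → ∀ᵐ A, P^A ≠ BQP^A`;
* `ae_not_quantumIII_of_quantumAdvantage : QuantumAdvantage → ∀ᵐ A, ¬ (PromiseBQP^A ⊆ promiseLift P^A)`
  — the quantum analogue of Hypothesis III fails almost surely, while Hypothesis III itself
  (`PromiseBPP'^A ⊆ promiseLift P^A`) holds almost surely (Literature `PromiseBPPRelAlmostP`);
* `ae_exists_BQPRel_not_mem_PRel_of_quantumAdvantage : QuantumAdvantage → ∀ᵐ A, ∃ L ∈ BQP^A, L ∉ P^A`,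
  witnessed uniformly by the summit's own language (`BQP ⊆ BQP^A`).

So the summit is EQUIVALENT to nothing here but IMPLIES its own measure-one relativisation against
`P^A` (and, with Bennett–Gill `BPP^A = P^A` a.e., against `BPP^A`); the converse — descending an
almost-sure `BQP^A ⊄ BPP^A` to the summit — is the random-oracle method, which fails in general and
for `BQP` is Aaronson–Ambainis territory (tree `RandomOracleMethod`).

## References
* [BennettGill1981] C. H. Bennett, J. Gill, SIAM J. Comput. 10 (1981), Lemma 1 and Thm. 5; via
  Book–Vollmer–Wagner, ICALP 1996, §3 Prop. 1–2, §4 Thm. 3 [corpus: book:editor1996-automata-languages-programming p.417–419].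
* [FortnowRogers1999JCSS] L. Fortnow, J. Rogers, JCSS 59 (1999), Thm. 4.4 (arXiv:cs/9811023 numbering, p. 8).
* [AaronsonAmbainis2014] S. Aaronson, A. Ambainis, Theory Comput. 10 (2014), Thm. 7 (iii).
-/

noncomputable section

namespace Summit.QuantumAdvantage.QuantumAdvantage.Theorems

open _root_.MeasureTheory _root_.Computability Literature.Computability.Complexity
  Literature.Computability.Complexity.Classes Literature.Computability.Complexity.OracleAlg
  Literature.Computability.Cryptography Literature.Computability.QuantumComplexity

/-! ### Bennett–Gill's descent consumes only positive measure -/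

/-- **Bennett–Gill, positive-measure form.** If the set of oracles `A` with `L ∈ P^A` is not null
under the random-oracle measure, then `L ∈ BPP`. (The tree's `almostP_subset_BPP_holds` assumes
measure one; its proof — `exists_table_of_pos` and the lazy-sampling simulator — uses only a witness
machine correct on positive measure, supplied here by countable subadditivity.)
[cite: BookVollmerWagner1996, §4 Thm. 3 and §3 Prop. 1–2 (p. 373–375)] [cite: BennettGill1981, Lemma 1] -/
theorem mem_BPP_of_measure_ne_zero {L : Language Bool}
    (h : randomOracleMeasure {A : Set (List Bool) | L ∈ PRel (Oracle.ofLanguage A)} ≠ 0) :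
    L ∈ BPP := by
  haveI : Countable (Polynomial ℕ) := countable_polynomial_nat
  haveI : Countable {M : OracleAlg Bool // M.IsPolyTime encodingBoolBool} :=
    (countable_setOf_isPolyTime encodingBoolBool).to_subtype
  -- Step 1': some witness `(M, q)` decides `L` on a set of oracles of positive measure.
  obtain ⟨M, q, hM, hpos⟩ : ∃ (M : OracleAlg Bool) (q : Polynomial ℕ), M.IsPolyTime encodingBoolBool ∧
      randomOracleMeasure {A | DecidesRel L M q A} ≠ 0 := by
    have h1 : randomOracleMeasure
        (⋃ i : {M : OracleAlg Bool // M.IsPolyTime encodingBoolBool} × Polynomial ℕ,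
          {A | DecidesRel L i.1.1 i.2 A}) ≠ 0 :=
      fun h0 => h (measure_mono_null (setOf_mem_PRel_subset_iUnion L) h0)
    obtain ⟨i, hi⟩ : ∃ i : {M : OracleAlg Bool // M.IsPolyTime encodingBoolBool} × Polynomial ℕ,
        randomOracleMeasure {A | DecidesRel L i.1.1 i.2 A} ≠ 0 := by
      by_contra hc
      push Not at hc
      exact h1 (measure_iUnion_null_iff.2 hc)
    exact ⟨i.1.1, i.2, i.1.2, hi⟩
  -- Steps 2–4 verbatim from the tree (`exists_table_of_pos`, lazy-sampling simulator in `P`).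
  obtain ⟨F, τ, hprob⟩ := exists_table_of_pos L M q hpos
  set M' := M.capQ q false with hM'
  have hcap : ∀ (x : List Bool) (as : List (List Bool)) (u : List Bool),
      M'.step x as = Sum.inl u → u.length ≤ q.eval x.length := fun x as u h' => capQ_step_eq_inl h'
  have hL'P := lazySamplingSimulatorInP_holds M' q (isPolyTime_capQ (eb := encodingBoolBool) hM q false)
    hcap F τ q
  refine ⟨_, hL'P, q, fun x => ?_⟩
  refine le_trans (by norm_num) ((hprob x).trans (PromiseCook.uniformProb_mono fun y hy => ?_))
  simp only [Set.mem_setOf_eq] at hy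
  change runWith M' (boolUnpair (boolPair x y)).1
      (coinAns M' F τ (boolUnpair (boolPair x y)).1 (boolUnpair (boolPair x y)).2)
      (q.eval (boolUnpair (boolPair x y)).1.length) [] = some true ↔ x ∈ L
  rw [boolUnpair_boolPair]
  dsimp only
  rw [hy]
  simp only [Option.some.injEq]
  exact (Set.mem_iff_boolIndicator L x).symm

/-- Filter form: if `L ∉ P^A` does NOT hold almost surely, then `L ∈ BPP`. [cite: BennettGill1981, Lemma 1 and Thm. 5] -/
theorem mem_BPP_of_not_ae_not_mem_PRel {L : Language Bool}
    (h : ¬ ∀ᵐ A : Set (List Bool) ∂randomOracleMeasure, L ∉ PRel (Oracle.ofLanguage A)) :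
    L ∈ BPP := by
  refine mem_BPP_of_measure_ne_zero fun h0 => h ?_
  rw [ae_iff]
  simpa only [not_not] using h0

/-! ### Fortnow–Rogers 4.4 in positive-measure form -/

/-- **If `P^A = BQP^A` on a non-null set of oracles, then `BQP = BPP`.** (`BQP ⊆ BQP^A` for every
`A`, so a `BQP` language is in `P^A` on that set; Bennett–Gill in positive-measure form puts it in
`BPP`; `BPP ⊆ BQP` is the tree theorem `BPP_subset_BQP_holds`.) [cite: FortnowRogers1999JCSS, Thm. 4.4 (arXiv numbering)] -/
theorem BQP_eq_BPP_of_not_ae_ne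
    (h : ¬ ∀ᵐ A : Set (List Bool) ∂randomOracleMeasure,
      PRel (Oracle.ofLanguage A) ≠ BQPRel (A : Language Bool)) :
    BQP = BPP := by
  refine Set.Subset.antisymm (fun L hL => ?_) BPP_subset_BQP_holds
  refine mem_BPP_of_not_ae_not_mem_PRel fun hae => h ?_
  filter_upwards [hae] with A hA heq
  exact hA (heq ▸ BQP_subset_BQPRel (A : Language Bool) hL)

/-! ### The summit's measure-one shadow -/

/-- **Under the summit, `P^A ≠ BQP^A` for almost every oracle** (sharpening the tree's
`not_ae_P_eq_BQP_of_summit_holds`, which only denies almost-sure equality; no zero-one law is used).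
[cite: FortnowRogers1999JCSS, Thm. 4.4 (arXiv numbering)] [cite: BennettGill1981, Thm. 5] -/
theorem ae_PRel_ne_BQPRel_of_quantumAdvantage (hS : QuantumAdvantage) :
    ∀ᵐ A : Set (List Bool) ∂randomOracleMeasure, PRel (Oracle.ofLanguage A) ≠ BQPRel (A : Language Bool) := by
  by_contra h
  obtain ⟨L, hL, hnL⟩ := hS
  exact hnL (BQP_eq_BPP_of_not_ae_ne h ▸ hL)

/-- **Under the summit, the summit's own language witnesses `BQP^A ⊄ P^A` almost surely**:
`∀ᵐ A, ∃ L ∈ BQP^A, L ∉ P^A`, with `L` the unrelativized witness. [cite: FortnowRogers1999JCSS, Thm. 4.4 (arXiv numbering)] -/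
theorem ae_exists_BQPRel_not_mem_PRel_of_quantumAdvantage (hS : QuantumAdvantage) :
    ∀ᵐ A : Set (List Bool) ∂randomOracleMeasure,
      ∃ L ∈ BQPRel (A : Language Bool), L ∉ PRel (Oracle.ofLanguage A) := by
  obtain ⟨L, hL, hnL⟩ := hS
  have hae : ∀ᵐ A : Set (List Bool) ∂randomOracleMeasure, L ∉ PRel (Oracle.ofLanguage A) := by
    by_contra h
    exact hnL (mem_BPP_of_not_ae_not_mem_PRel h)
  filter_upwards [hae] with A hA
  exact ⟨L, BQP_subset_BQPRel (A : Language Bool) hL, hA⟩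

/-- **Under the summit, quantum Hypothesis III fails almost surely**: for almost every `A` some
`PromiseBQP^A` problem (indeed a trivial-promise one) has no `P^A`-language solution — whereas
classical Hypothesis III `PromiseBPP'^A ⊆ promiseLift P^A` holds almost surely
(`Literature.Computability.Complexity.promiseBPP'Rel_subset_promiseLift_PRel_ae`).
[cite: FortnowRogers1999JCSS, Thm. 4.4 (arXiv numbering)] [cite: Goldreich2006, Def. 1.2] -/
theorem ae_not_quantumIII_of_quantumAdvantage (hS : QuantumAdvantage) :
    ∀ᵐ A : Set (List Bool) ∂randomOracleMeasure,
      ¬ (PromiseBQPRel (A : Language Bool) ⊆ promiseLift (PRel (Oracle.ofLanguage A))) := by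
  filter_upwards [ae_exists_BQPRel_not_mem_PRel_of_quantumAdvantage hS] with A hA h
  obtain ⟨L, hL, hnL⟩ := hA
  exact hnL (ofLanguage_mem_promiseLift_iff.1 (h (ofLanguage_mem_PromiseBQPRel_iff.2 hL)))

/-- Summary: `QuantumAdvantage → (∀ᵐ A, P^A ≠ BQP^A) ∧ (∀ᵐ A, ¬ Q-III^A)`; and the positive-measure
collapse principle `(¬ ∀ᵐ A, P^A ≠ BQP^A) → BQP = BPP`. [cite: FortnowRogers1999JCSS, Thm. 4.4 (arXiv numbering)] -/
theorem summit_randomOracle_shadow :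
    (QuantumAdvantage →
      (∀ᵐ A : Set (List Bool) ∂randomOracleMeasure, PRel (Oracle.ofLanguage A) ≠ BQPRel (A : Language Bool)) ∧
        ∀ᵐ A : Set (List Bool) ∂randomOracleMeasure,
          ¬ (PromiseBQPRel (A : Language Bool) ⊆ promiseLift (PRel (Oracle.ofLanguage A)))) ∧
      ((¬ ∀ᵐ A : Set (List Bool) ∂randomOracleMeasure,
          PRel (Oracle.ofLanguage A) ≠ BQPRel (A : Language Bool)) → BQP = BPP) :=
  ⟨fun hS => ⟨ae_PRel_ne_BQPRel_of_quantumAdvantage hS, ae_not_quantumIII_of_quantumAdvantage hS⟩,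
    BQP_eq_BPP_of_not_ae_ne⟩

end Summit.QuantumAdvantage.QuantumAdvantage.Theorems

end
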